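import Literature.Barriers.RiemannHypothesis.TuranMinWitnessCells
import HarnessLib

/-!
# Certified evaluation of `T(72 204 113 780 255)`: soundness of the certificate

Barrier catalogue `Literature/Barriers/RiemannHypothesis/`, support file for the discharge of
`Literature.Barriers.RiemannHypothesis.BFM2008_thm1_minWitness`. The last, computation-free layer over
`TuranMinWitnessCalc.lean`: if the parameters are valid (`Params.valid`), the cells of a certificate
tile the double sum of `main_identity` (`cellsOf`), every cell check passes (`cellCheck … = true`, the
`native_decide` blocks `TuranMinWitness/Run*.lean`) and the final comparison passes
(`finalCheck … = true`), then `T(N) < 0` (`Tn_neg_of_certificate`).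

## The argument

`T(N) = MQ − ∑_{d ≤ D} (μ(d)/d) ∑_{k ≤ kmax(d)} f_d(k)` (`main_identity`); the inner range
`(0, kmax(d)]` is cut at `cut 0 d = 0 ≤ cut 1 d ≤ ⋯ ≤ cut I d = kmax(d)` (`I = nLog + 2 + #cuts`,
monotone for valid parameters), so the double sum is `∑_{i<I} cellSum p i 0 D`; the small cell
`i = nLog` is further split along the `d`-boundaries of the certificate. Each `cellCheck` gives a
certified lower bound `L_c ≤ 2^167 · cellSum_c` (`cellCheck_sound`), `mainTermEncl` an upper bound
`2^110 MQ ≤ M.hi` (`mem_mainTermEncl`), and `finalCheck` is `2^57 M.hi < ∑ L_c`.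

## References

* [BorweinFergusonMossinghoff2008] P. Borwein, R. Ferguson, M. J. Mossinghoff, Math. Comp. 77
  (2008), 1681–1694, Thm. 1.
-/

open Finset ArithmeticFunction
open Literature.Analysis.ValidatedNumerics.NumericsMP

namespace Literature.Barriers.RiemannHypothesis.TuranMinWitness

/-! ## Valid parameters and monotone cuts -/

/-- `sortedLE l`: the list is nondecreasing (a `Bool`-valued, structurally recursive test). [folklore] -/
def sortedLE : List ℕ → Bool
  | [] => true
  | [_] => true
  | a :: b :: l => decide (a ≤ b) && sortedLE (b :: l)

/-- Unfolding `sortedLE` on two heads. [folklore] -/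
theorem sortedLE_cons_cons {a b : ℕ} {l : List ℕ} :
    sortedLE (a :: b :: l) = true ↔ a ≤ b ∧ sortedLE (b :: l) = true := by
  simp [sortedLE]

/-- The tail of a sorted list is sorted. [folklore] -/
theorem sortedLE_tail {a : ℕ} {l : List ℕ} (h : sortedLE (a :: l) = true) : sortedLE l = true := by
  cases l with
  | nil => rfl
  | cons b l => exact (sortedLE_cons_cons.1 h).2

/-- Consecutive elements of a sorted list. [folklore] -/
theorem sortedLE_getElem {l : List ℕ} (h : sortedLE l = true) {i : ℕ} (hi : i + 1 < l.length) :
    l[i] ≤ l[i + 1] := by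
  induction l generalizing i with
  | nil => simp at hi
  | cons a l ih =>
    cases l with
    | nil => simp at hi
    | cons b l =>
      obtain ⟨hab, ht⟩ := sortedLE_cons_cons.1 h
      cases i with
      | zero => simpa using hab
      | succ i =>
        have := ih ht (i := i) (by simpa using hi)
        simpa using this

/-- In a sorted list bounded by the default, `getD` is monotone in the index. [folklore] -/
theorem getD_le_getD_succ {l : List ℕ} (hl : sortedLE l = true) {n : ℕ} (hn : ∀ x ∈ l, x ≤ n) (j : ℕ) :
    l.getD j n ≤ l.getD (j + 1) n := by
  rcases Nat.lt_or_ge (j + 1) l.length with h | h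
  · rw [List.getD_eq_getElem _ _ (by omega), List.getD_eq_getElem _ _ h]
    exact sortedLE_getElem hl h
  · rw [List.getD_eq_default _ _ h]
    rcases Nat.lt_or_ge j l.length with h' | h'
    · rw [List.getD_eq_getElem _ _ h']
      exact hn _ (List.getElem_mem h')
    · rw [List.getD_eq_default _ _ h']

namespace Params

/-- Validity of the parameters (a decidable, `Bool`-valued conjunction): `1 ≤ D ≤ N`, `W ≤ N`,
`1 ≤ β`, the log cuts increase and are `≤ E₀ ≤ W`, the sieve cuts increase from `W` and are `≤ N`.
[folklore] -/
def valid (p : Params) : Bool :=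
  decide (1 ≤ p.D) && decide (p.D ≤ p.N) && decide (p.W ≤ p.N) && decide (1 ≤ p.beta) &&
    sortedLE p.logCuts && decide (∀ x ∈ p.logCuts, x ≤ p.E0) && decide (p.E0 ≤ p.W) &&
    sortedLE (p.W :: p.cuts) && decide (∀ x ∈ p.cuts, x ≤ p.N)

/-- The number of cells in the `k`-direction: `nLog + 2 + #cuts`. [folklore] -/
def nCells (p : Params) : ℕ := p.nLog + 2 + p.cuts.length

variable {p : Params}

/-- Unpacking `valid`. [folklore] -/
theorem valid_iff : p.valid = true ↔
    (1 ≤ p.D ∧ p.D ≤ p.N ∧ p.W ≤ p.N ∧ 1 ≤ p.beta ∧ sortedLE p.logCuts = true ∧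
      (∀ x ∈ p.logCuts, x ≤ p.E0) ∧ p.E0 ≤ p.W ∧ sortedLE (p.W :: p.cuts) = true ∧
        ∀ x ∈ p.cuts, x ≤ p.N) := by
  unfold valid
  simp only [Bool.and_eq_true, decide_eq_true_eq, and_assoc]

/-- `ℓ` is monotone for valid parameters. [folklore] -/
theorem ell_le_ell_succ (hv : p.valid = true) (j : ℕ) : p.ell j ≤ p.ell (j + 1) := by
  obtain ⟨-, -, -, -, hch, hle, -, -, -⟩ := valid_iff.1 hv
  unfold ell
  rcases Nat.eq_zero_or_pos j with rfl | hj
  · simp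
  · rw [if_neg (show j ≠ 0 by omega), if_neg (show j + 1 ≠ 0 by omega)]
    by_cases h1 : j + 1 ≤ p.logCuts.length
    · rw [if_pos (show j ≤ p.logCuts.length by omega), if_pos h1, List.getD_eq_getElem _ _ (by omega),
        List.getD_eq_getElem _ _ (by omega)]
      have := sortedLE_getElem hch (i := j - 1) (by omega)
      simpa [show j - 1 + 1 = j + 1 - 1 by omega] using this
    · rw [if_neg h1]
      by_cases h2 : j ≤ p.logCuts.length
      · rw [if_pos h2, List.getD_eq_getElem _ _ (by omega)]
        exact hle _ (List.getElem_mem _)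
      · rw [if_neg h2]

/-- The raw cuts are monotone in `i` for valid parameters. [folklore] -/
theorem rawCut_le_succ (hv : p.valid = true) (d i : ℕ) : p.rawCut i d ≤ p.rawCut (i + 1) d := by
  obtain ⟨-, -, hWN, -, -, -, hE0W, hch, hcN⟩ := valid_iff.1 hv
  unfold rawCut
  by_cases h : i + 1 ≤ p.nLog
  · rw [if_pos (by omega), if_pos h]
    exact Nat.div_le_div_right (ell_le_ell_succ hv i)
  · by_cases h' : i ≤ p.nLog
    · -- `i = nLog`: `E₀ / d ≤ W`
      have hi : i = p.nLog := by omega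
      subst hi
      rw [if_pos le_rfl, if_neg h, if_pos rfl, ell_nLog]
      exact (Nat.div_le_self _ _).trans hE0W
    · rw [if_neg h', if_neg h]
      by_cases h'' : i = p.nLog + 1
      · -- `i = nLog + 1`: `W ≤ cuts.getD 0 N`
        subst h''
        rw [if_pos rfl, if_neg (by omega), show p.nLog + 1 + 1 - p.nLog - 2 = 0 by omega]
        cases hc : p.cuts with
        | nil => simpa [Params.y] using hWN
        | cons a l => rw [hc] at hch; simpa using (sortedLE_cons_cons.1 hch).1
      · rw [if_neg h'', if_neg (by omega), show i + 1 - p.nLog - 2 = (i - p.nLog - 2) + 1 by omega]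
        have hyN : ∀ x ∈ p.cuts, x ≤ p.y 1 := by
          intro x hx; rw [Params.y, Nat.div_one]; exact hcN x hx
        exact getD_le_getD_succ (sortedLE_tail hch) hyN _

/-- The cuts are monotone in `i`. [folklore] -/
theorem cut_le_succ (hv : p.valid = true) (d i : ℕ) : p.cut i d ≤ p.cut (i + 1) d :=
  min_le_min_left _ (rawCut_le_succ hv d i)

/-- `cut 0 d = 0`. [folklore] -/
theorem cut_zero (p : Params) (d : ℕ) : p.cut 0 d = 0 := by
  unfold cut rawCut ell; simp

/-- `cut nCells d = kmax d` (the last raw cut is `N ≥ kmax d`). [folklore] -/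
theorem cut_nCells (p : Params) (d : ℕ) : p.cut p.nCells d = p.kmax d := by
  unfold cut rawCut nCells
  rw [if_neg (by omega), if_neg (by omega), show p.nLog + 2 + p.cuts.length - p.nLog - 2 = p.cuts.length by omega,
    List.getD_eq_default _ _ le_rfl]
  apply min_eq_left
  unfold kmax y
  rw [Nat.div_one]
  exact (Nat.div_le_self _ _).trans (Nat.div_le_self _ _)

end Params

/-! ## Telescoping the pieces -/

/-- `∑_{i<I} pieceSum p i d = ∑_{0 < k ≤ cut I d} f_d(k)` for valid parameters. [folklore] -/
theorem sum_pieceSum {p : Params} (hv : p.valid = true) (d I : ℕ) :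
    ∑ i ∈ range I, pieceSum p i d = ∑ k ∈ Ioc 0 (p.cut I d), fterm (p.y d) (p.m0 d) k := by
  induction I with
  | zero => simp [Params.cut_zero]
  | succ n ih =>
    rw [sum_range_succ, ih, pieceSum]
    exact sum_Ioc_consecutive _ (Nat.zero_le _) (Params.cut_le_succ hv d n)

/-- **The double sum of `main_identity` is the sum of all cells.** [folklore] -/
theorem doubleSum_eq_sum_cellSum {p : Params} (hv : p.valid = true) :
    ∑ d ∈ Ioc 0 p.D, (moebius d : ℝ) / d *
        ∑ k ∈ Ioc 0 (p.N / d / (p.D / d + 1)), (liouville k : ℝ) / k * (Hn (p.N / d / k) - Hn (p.D / d)) =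
      ∑ i ∈ range p.nCells, cellSum p i 0 p.D := by
  unfold cellSum
  rw [sum_comm]
  refine sum_congr rfl fun d _ => ?_
  rw [← mul_sum, sum_pieceSum hv d, Params.cut_nCells p d]
  rfl

/-! ## The cells of a certificate -/

/-- The small cells along the boundaries `0 = b₀ ≤ b₁ ≤ ⋯`: `(nLog, b_j, b_{j+1})`. [folklore] -/
def smallCells (p : Params) (dB : List ℕ) : List (ℕ × ℕ × ℕ) :=
  (List.zip (0 :: dB) dB).map fun ab => (p.nLog, ab.1, ab.2)

/-- All cells of a certificate with small-cell boundaries `dB`: the log cells `(i, 0, D)`, `i < nLog`,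
the small cells, and the sieve cells `(i, 0, D)`, `nLog < i < nCells`. [folklore] -/
def cellsOf (p : Params) (dB : List ℕ) : List (ℕ × ℕ × ℕ) :=
  (List.range p.nLog).map (fun i => (i, 0, p.D)) ++ smallCells p dB ++
    (List.range (p.cuts.length + 1)).map fun j => (p.nLog + 1 + j, 0, p.D)

/-- The small-cell boundaries are admissible: increasing from `0` and ending at `D`. [folklore] -/
def smallBoundsOK (p : Params) (dB : List ℕ) : Bool :=
  sortedLE (0 :: dB) && decide (dB.getLastD 0 = p.D)

/-- The value of a cell triple. [folklore] -/
noncomputable def cellVal (p : Params) (c : ℕ × ℕ × ℕ) : ℝ := cellSum p c.1 c.2.1 c.2.2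

/-- List sums over `range`. [folklore] -/
theorem sum_map_range (f : ℕ → ℝ) (n : ℕ) : ((List.range n).map f).sum = ∑ i ∈ range n, f i := by
  induction n with
  | zero => simp
  | succ n ih => rw [List.range_succ, List.map_append, List.sum_append, ih, sum_range_succ]; simp

/-- The small cells along a chain telescope. [folklore] -/
theorem sum_smallCells_aux (p : Params) : ∀ (a : ℕ) (l : List ℕ), sortedLE (a :: l) = true →
    ((List.zip (a :: l) l).map (fun ab => cellSum p p.nLog ab.1 ab.2)).sum =
      cellSum p p.nLog a (l.getLastD a) ∧ a ≤ l.getLastD a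
  | a, [], _ => by simp [cellSum]
  | a, b :: l, h => by
    obtain ⟨hab, ht⟩ := sortedLE_cons_cons.1 h
    obtain ⟨ih1, ih2⟩ := sum_smallCells_aux p b l ht
    simp only [List.zip_cons_cons, List.map_cons, List.sum_cons, List.getLastD_cons] at ih1 ih2 ⊢
    rw [ih1]
    refine ⟨?_, hab.trans ih2⟩
    rw [cellSum, cellSum, cellSum, sum_Ioc_consecutive _ hab ih2]

/-- **The cells of a certificate sum to the double sum.** [folklore] -/
theorem sum_cellsOf (p : Params) {dB : List ℕ} (hdB : smallBoundsOK p dB = true) :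
    ((cellsOf p dB).map (cellVal p)).sum = ∑ i ∈ range p.nCells, cellSum p i 0 p.D := by
  unfold smallBoundsOK at hdB
  simp only [Bool.and_eq_true, decide_eq_true_eq] at hdB
  obtain ⟨hch, hlast⟩ := hdB
  have hsmall : ((smallCells p dB).map (cellVal p)).sum = cellSum p p.nLog 0 p.D := by
    rw [smallCells, List.map_map]
    have := (sum_smallCells_aux p 0 dB hch).1
    rw [hlast] at this
    rw [← this]
    rfl
  rw [cellsOf, List.map_append, List.map_append, List.sum_append, List.sum_append, hsmall,
    List.map_map, List.map_map]
  have e1 : ((List.range p.nLog).map (cellVal p ∘ fun i => (i, 0, p.D))).sum =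
      ∑ i ∈ range p.nLog, cellSum p i 0 p.D := sum_map_range _ _
  have e2 : ((List.range (p.cuts.length + 1)).map (cellVal p ∘ fun j => (p.nLog + 1 + j, 0, p.D))).sum =
      ∑ j ∈ range (p.cuts.length + 1), cellSum p (p.nLog + 1 + j) 0 p.D := sum_map_range _ _
  rw [e1, e2, Params.nCells]
  have e3 : ∑ i ∈ range (p.nLog + 2 + p.cuts.length), cellSum p i 0 p.D =
      ∑ i ∈ range p.nLog, cellSum p i 0 p.D + cellSum p p.nLog 0 p.D +
        ∑ j ∈ range (p.cuts.length + 1), cellSum p (p.nLog + 1 + j) 0 p.D := by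
    rw [show p.nLog + 2 + p.cuts.length = (p.nLog + 1) + (p.cuts.length + 1) by ring,
      Finset.sum_range_add, Finset.sum_range_succ]
  rw [e3]

/-! ## The final theorem -/

/-- **Soundness of the certificate.** For valid parameters, admissible small-cell boundaries `dB`,
a certificate `cert` (cells with claimed lower bounds) whose cells are `cellsOf p dB`, if every cell
check passes and the final comparison passes then `T(N) < 0`. [folklore] -/
theorem Tn_neg_of_certificate (p : Params) (hv : p.valid = true) (dB : List ℕ)
    (hdB : smallBoundsOK p dB = true) (cert : List ((ℕ × ℕ × ℕ) × ℤ))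
    (hcert : cert.map Prod.fst = cellsOf p dB)
    (hall : ∀ c ∈ cert, cellCheck p c.1.1 c.1.2.1 c.1.2.2 c.2 = true)
    (hfin : finalCheck p (cert.map Prod.snd) = true) : Tn p.N < 0 := by
  obtain ⟨hD, hDN, -, hβ, -⟩ := Params.valid_iff.1 hv
  -- the identity
  have hid := main_identity hD hDN (N := p.N)
  set MQ := ∑ d ∈ Ioc 0 p.D, (moebius d : ℝ) / d * Qn (p.N / d) with hMQ
  set total := ∑ i ∈ range p.nCells, cellSum p i 0 p.D with htotal
  have hT : Tn p.N = MQ - total := by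
    rw [hid, htotal, ← doubleSum_eq_sum_cellSum hv, hMQ, ← sum_sub_distrib]
    exact sum_congr rfl fun d _ => by ring
  -- the certified bounds
  have hcells : ((cert.map Prod.snd).sum : ℝ) ≤ total * (2 ^ SR : ℕ) := by
    have h1 : total = (cert.map (fun c => cellVal p c.1)).sum := by
      rw [htotal, ← sum_cellsOf p hdB, ← hcert, List.map_map]; rfl
    have h2 : (((cert.map Prod.snd).sum : ℤ) : ℝ) = (cert.map (fun c => ((c.2 : ℤ) : ℝ))).sum := by
      rw [Int.cast_list_sum, List.map_map]; rfl
    rw [h1, h2, ← List.sum_map_mul_right]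
    exact List.sum_le_sum fun c hc => cellCheck_sound p hβ (hall c hc)
  have hmain : MQ * ((2 ^ ST : ℕ) : ℝ) ≤ ((mainTermEncl p).hi : ℝ) := (mem_mainTermEncl p).2
  -- the final comparison
  unfold finalCheck at hfin
  have hfin' : (mainTermEncl p).hi * 2 ^ (SR - ST) < (cert.map Prod.snd).sum := of_decide_eq_true hfin
  have hfinR : ((mainTermEncl p).hi : ℝ) * 2 ^ (SR - ST) < (((cert.map Prod.snd).sum : ℤ) : ℝ) := by
    exact_mod_cast hfin'
  have pSR : ((2 ^ SR : ℕ) : ℝ) = 2 ^ ST * 2 ^ (SR - ST) := by norm_num [SR, ST]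
  have pST : ((2 ^ ST : ℕ) : ℝ) = 2 ^ ST := by norm_num
  rw [pST] at hmain
  rw [pSR] at hcells
  have hpos : (0 : ℝ) < 2 ^ ST * 2 ^ (SR - ST) := by positivity
  have h57 : (0 : ℝ) ≤ 2 ^ (SR - ST) := by positivity
  have hMQ' : MQ * 2 ^ ST * 2 ^ (SR - ST) ≤ ((mainTermEncl p).hi : ℝ) * 2 ^ (SR - ST) :=
    mul_le_mul_of_nonneg_right hmain h57
  have hneg : Tn p.N * (2 ^ ST * 2 ^ (SR - ST)) < 0 := by
    rw [hT]; nlinarith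
  exact neg_of_mul_neg_left hneg hpos.le

end Literature.Barriers.RiemannHypothesis.TuranMinWitness
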